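import Literature.NumberTheory.EllipticCurves.SemistableModPImageMultiplicativeProofs
import Literature.NumberTheory.EllipticCurves.KodairaNeronUnramifiedInertiaProofs
import Literature.NumberTheory.EllipticCurves.GeomPointsGaloisModule
import Literature.NumberTheory.EllipticCurves.OrdinaryReductionInertiaShapeProofs
import HarnessLib

/-!
# The line of the Tate form at a multiplicative `v ∣ p`, for the local inertia group
# (Serre 1972, §1.12, Cor. of Prop. 13: `ρ̄_{E,p}|I_v ≃ (χ *; 0 1)`)

`Proofs` file (theorems only: no definition, no named fact), topic `NumberTheory/EllipticCurves`;
the LOCAL form of `SemistableModPImageMultiplicativeProofs`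
(`WeierstrassCurve.exists_addSubgroup_card_le_of_hasMultiplicativeReductionAt`, stated there for a
prime `𝔓` of `\bar ℤ_K` and its inertia group in `Γ_K`): here the inertia group is the inertia
group `absInertia K_v ≤ Γ_{K_v}` of the completion, acting on `E(K̄)` through the restriction
`absGaloisRestrict K K_v : Γ_{K_v} → Γ_K` of the tree's chosen embedding `K̄ → K̄_v` — the form in
which Serre's recipe (`ModPGaloisRep.LocalRestrictionAt`, `serreWeight`) reads a global mod `p`
representation.

* `WeierstrassCurve.exists_line_le_geomTorsion_of_hasMultiplicativeReductionAt` — for an elliptic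
  curve `E/K`, an odd prime `p` and a place `v ∣ p` of multiplicative reduction there is a
  subgroup `Λ ≤ E[p]` with `#Λ ≤ p` containing `τ P - P` for all `τ ∈ I_{K_v}`, `P ∈ E[p]`;
* `WeierstrassCurve.hasLevelOneInertiaShape_restrictField_of_hasMultiplicativeReductionAt` — when
  moreover `e(v ∣ p) = f(v ∣ p) = 1` (`p` a uniformiser of `K_v`, `#k_v = p`; e.g. `K = ℚ`): `#Λ = p`
  exactly (`χ̄_p = ψ₁` is ramified at `v`, so `I_{K_v}` does not act trivially on `E[p]`), and the
  local representation `(ρ̄_{E,p} ⊗_j k)|Γ_{K_v}` of a framing `ρ̄` of `E[p]` has the level-one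
  inertia shape `(ψ₁ *; 0 1)` of Serre's recipe (`HasLevelOneInertiaShape ι p _ 1 0`), exactly as at
  a good ordinary prime (`OrdinaryReductionInertiaShapeProofs`, whose conversion is reused:
  `IsTorsionGaloisRep.exists_conj_eq_of_line`, `det = χ̄_p`,
  `coe_fundamentalCharacter_one_eq_modPCyclotomicCharacter`).  Serre 1987, §2.8 (2.8.2)–(2.8.3),
  §2.9 ("mauvaise réduction de type multiplicatif": `ρ_p|I = (χ *; 0 1)`).

The proof is that of the global statement verbatim (Tate form of invariant `j` over `K_v`,
unramified twist because `c₄, c₆` are units and `p ≠ 2`, the kernel of reduction of the Tate form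
has at most `p` points of order `p`), with the identification `I_𝔐 = absInertia K_v`
(`inertia_eq_absInertia`) and the equivariance `pointsMap_smul` of `E(K̄) → E(K̄_v)` in place of the
passage to a global prime.  See that file for the mathematics and the citations.

## References

* [SerreInventiones1972] J.-P. Serre, Invent. Math. 15 (1972), §1.12 (Prop. 13 and Cor.).
* [Serre1987] J.-P. Serre, Duke Math. J. 54 (1987), §2.8 (2.8.2)–(2.8.3) and §2.9.
* [SilvermanATAEC1994] J. H. Silverman, *Advanced Topics*, V.3–V.5.
-/

noncomputable section

open scoped Classical NNReal NumberField Pointwise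
open NumberField IsDedekindDomain Field

namespace WeierstrassCurve

open Literature.NumberTheory.EllipticCurves Literature.NumberTheory.GaloisRepresentations Field
  IsDedekindDomain.HeightOneSpectrum ValuativeRel
  Literature.NumberTheory.GaloisRepresentations.IsNonarchimedeanLocalField
  Literature.NumberTheory.GaloisRepresentations.ModPGaloisRep

variable {K : Type} [Field K] [NumberField K] (W : WeierstrassCurve K)

/-- **Serre 1972, §1.12, Cor. of Prop. 13, local form: at a multiplicative `v ∣ p` (`p` odd) the
inertia group `I_{K_v}` moves `E[p]` into a subgroup of order `≤ p`.**  For an elliptic curve `E`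
over a number field `K`, an odd prime `p` and a finite place `v ∣ p` of multiplicative reduction,
there is a subgroup `Λ ≤ E[p]` with `#Λ ≤ p` such that `τ P - P ∈ Λ` for every `P ∈ E[p]` and every
`τ` in the inertia group of `K_v`, acting through `absGaloisRestrict K K_v` (so `I_{K_v}` acts
trivially on `E[p]/Λ`).  Proof: as `exists_addSubgroup_card_le_of_hasMultiplicativeReductionAt`
(`Λ` = the points whose image on the Tate form of invariant `j(E)` over `K̄_v` reduces to `O`).
[cite: SerreInventiones1972, §1.12, Cor. of Prop. 13] -/
theorem exists_line_le_geomTorsion_of_hasMultiplicativeReductionAt [W.IsElliptic]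
    {v : HeightOneSpectrum (𝓞 K)} {p : ℕ} [hp : Fact p.Prime] (hp2 : p ≠ 2)
    (hpv : (p : 𝓞 K) ∈ v.asIdeal) (hmult : W.HasMultiplicativeReductionAt v) :
    ∃ Λ : AddSubgroup (geomPoints W), Λ ≤ geomTorsion W (p : ℤ) ∧ Nat.card Λ ≤ p ∧
      ∀ τ ∈ absInertia (v.adicCompletion K), ∀ P ∈ geomTorsion W (p : ℤ),
        absGaloisRestrict K (v.adicCompletion K) τ • P - P ∈ Λ := by
  obtain ⟨w, hw⟩ := v.exists_spectralValuation
  obtain ⟨𝔐, h𝔐⟩ := v.localPrimesAbove_nonempty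
  have hvw : w.Integers w.integer := Valuation.integer.integers w
  -- the Tate form of invariant `j` over `K_v`
  have hjw : 1 < w (algebraMap K (AlgebraicClosure (v.adicCompletion K)) W.j) :=
    W.one_lt_spectralValuation_j_of_hasMultiplicativeReductionAt hw hmult
  obtain ⟨hj0, hj1728, hT, ha₆, -, -⟩ := W.isTateForm_tateFormOfJ_of_one_lt hjw
  set jv : (v.adicCompletion K) := algebraMap K (v.adicCompletion K) W.j with hjv
  haveI hTell : (tateFormOfJ jv).IsElliptic := isElliptic_tateFormOfJ hj0 hj1728
  haveI : CharZero (v.adicCompletion K) := charZero_of_injective_algebraMap (algebraMap K (v.adicCompletion K)).injective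
  have hjW : (W.baseChange (v.adicCompletion K)).j = jv := W.map_j _
  have hjE : (W.baseChange (v.adicCompletion K)).j = (tateFormOfJ jv).j := by
    rw [hjW, tateFormOfJ_j hj0 hj1728]
  have hjE0 : (W.baseChange (v.adicCompletion K)).j ≠ 0 := by rw [hjW]; exact hj0
  have hjE1728 : (W.baseChange (v.adicCompletion K)).j ≠ 1728 := by rw [hjW]; exact hj1728
  -- the twisting isomorphism with its parameter
  obtain ⟨e, u, hu0, ⟨r, hr0, hur⟩, he⟩ := exists_addEquiv_baseChange_of_j_eq_map_algEquiv_c₄c₆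
    (W.baseChange (v.adicCompletion K)) (tateFormOfJ jv) (AlgebraicClosure (v.adicCompletion K)) hjE hjE0 hjE1728
  set f := algebraMap (v.adicCompletion K) (AlgebraicClosure (v.adicCompletion K)) with hf
  -- (1) the minimal model `X = C • E_{K_v}` has unit `c₄`, `c₆`; so has the Tate form
  obtain ⟨C, hC⟩ : ∃ C : VariableChange (v.adicCompletion K), W.localMinimalModel v = C • W.baseChange (v.adicCompletion K) :=
    ⟨_, rfl⟩
  set I := W.localMinimalIntegralModel v with hIdef
  obtain ⟨hΔm, hc₄m⟩ := (hasMultiplicativeReductionAt_iff_mem v W).mp hmult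
  have hc₄u : IsUnit I.c₄ := by
    by_contra h
    exact hc₄m ((IsLocalRing.mem_maximalIdeal _).mpr (mem_nonunits_iff.mpr h))
  have hc₆u : IsUnit I.c₆ := by
    by_contra h
    have hc₆m : I.c₆ ∈ IsLocalRing.maximalIdeal _ :=
      (IsLocalRing.mem_maximalIdeal _).mpr (mem_nonunits_iff.mpr h)
    apply hc₄m
    refine Ideal.IsPrime.mem_of_pow_mem inferInstance 3 ?_
    rw [show I.c₄ ^ 3 = I.c₆ ^ 2 + 1728 * I.Δ by linear_combination -I.c_relation]
    exact Ideal.add_mem _ (Ideal.pow_mem_of_mem _ hc₆m 2 two_pos) (Ideal.mul_mem_left _ _ hΔm)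
  have hXI : I.baseChange (v.adicCompletion K) = W.localMinimalModel v :=
    baseChange_integralModel_eq (v.adicCompletionIntegers K) (W.localMinimalModel v)
  have hXc₄ : (W.localMinimalModel v).c₄ = algebraMap _ (v.adicCompletion K) I.c₄ := by
    rw [← hXI]; exact (I.map_c₄ _)
  have hXc₆ : (W.localMinimalModel v).c₆ = algebraMap _ (v.adicCompletion K) I.c₆ := by
    rw [← hXI]; exact (I.map_c₆ _)
  have hwc₄ : w (f (W.localMinimalModel v).c₄) = 1 := by
    rw [hXc₄]; exact spectralValuation_eq_one_of_isUnit hw hc₄u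
  have hwc₆ : w (f (W.localMinimalModel v).c₆) = 1 := by
    rw [hXc₆]; exact spectralValuation_eq_one_of_isUnit hw hc₆u
  have hEc₄ : (W.baseChange (v.adicCompletion K)).c₄ = (C.u : (v.adicCompletion K)) ^ 4 * (W.localMinimalModel v).c₄ := by
    rw [hC, variableChange_c₄, Units.val_inv_eq_inv_val, ← mul_assoc, ← mul_pow,
      mul_inv_cancel₀ C.u.ne_zero, one_pow, one_mul]
  have hEc₆ : (W.baseChange (v.adicCompletion K)).c₆ = (C.u : (v.adicCompletion K)) ^ 6 * (W.localMinimalModel v).c₆ := by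
    rw [hC, variableChange_c₆, Units.val_inv_eq_inv_val, ← mul_assoc, ← mul_pow,
      mul_inv_cancel₀ C.u.ne_zero, one_pow, one_mul]
  have hTc₄ : w (f (tateFormOfJ jv).c₄) = 1 := by
    rw [hf, ← map_c₄]; exact hT.valuation_c₄ w
  have hTc₆ : w (f (tateFormOfJ jv).c₆) = 1 := by
    rw [hf, ← map_c₆]; exact hT.valuation_c₆ w
  have hXc₄0 : (W.localMinimalModel v).c₄ ≠ 0 := fun h0 ↦ by
    rw [h0, map_zero, Valuation.map_zero] at hwc₄; exact zero_ne_one hwc₄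
  have hTc₆0 : (tateFormOfJ jv).c₆ ≠ 0 := fun h0 ↦ by
    rw [h0, map_zero, Valuation.map_zero] at hTc₆; exact zero_ne_one hTc₆
  have hXc₆0 : (W.localMinimalModel v).c₆ ≠ 0 := fun h0 ↦ by
    rw [h0, map_zero, Valuation.map_zero] at hwc₆; exact zero_ne_one hwc₆
  have hTc₄0 : (tateFormOfJ jv).c₄ ≠ 0 := fun h0 ↦ by
    rw [h0, map_zero, Valuation.map_zero] at hTc₄; exact zero_ne_one hTc₄
  -- (2) the unit `u' = u · r⁻¹ · u_C⁻¹` with `u'² = c₆(X) c₄(T) / (c₄(X) c₆(T))`; so `|u'| = 1`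
  set u' : (AlgebraicClosure (v.adicCompletion K)) := u * f (r⁻¹ * (C.u : (v.adicCompletion K))⁻¹) with hu'
  have hu'2 : u' ^ 2 = f ((W.localMinimalModel v).c₆ * (tateFormOfJ jv).c₄ /
      ((W.localMinimalModel v).c₄ * (tateFormOfJ jv).c₆)) := by
    rw [hu', mul_pow, hur, ← map_pow, ← map_mul, hEc₄, hEc₆]
    congr 1
    have hCu : (C.u : (v.adicCompletion K)) ≠ 0 := C.u.ne_zero
    field_simp
  have hwu' : w u' = 1 := by
    have h2 : w u' ^ 2 = 1 := by
      rw [← Valuation.map_pow, hu'2, map_div₀, map_mul, map_mul, Valuation.map_div,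
        Valuation.map_mul, Valuation.map_mul, hwc₆, hTc₄, hwc₄, hTc₆]
      simp
    exact (pow_eq_one_iff.mp h2).resolve_right two_ne_zero
  -- (3) every inertia element fixes `u`
  have h2w : w (2 : (AlgebraicClosure (v.adicCompletion K))) = 1 := by
    have := spectralValuation_intCast_eq_one hw (two_not_mem_asIdeal_of_prime_mem hp.out hp2 hpv)
    simpa using this
  have hfixu : ∀ σ ∈ 𝔐.inertia (absoluteGaloisGroup (v.adicCompletion K)),
      absoluteGaloisGroup.toAlgEquiv (v.adicCompletion K) σ u = u := by
    intro σ hσ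
    set σE : (AlgebraicClosure (v.adicCompletion K)) ≃ₐ[(v.adicCompletion K)] (AlgebraicClosure (v.adicCompletion K)) := absoluteGaloisGroup.toAlgEquiv _ σ with hσE
    rcases (he σE).1 with hfix | hneg
    · exact hfix
    · exfalso
      have hσu' : σE u' = -u' := by
        rw [hu', map_mul, hneg, AlgEquiv.commutes, neg_mul]
      have hlt := (mem_inertia_iff_spectralValuation hw h𝔐).mp hσ u' hwu'.le
      have heq : σ • u' - u' = -(2 * u') := by
        change σE u' - u' = -(2 * u')
        rw [hσu']; ring
      rw [heq, Valuation.map_neg, Valuation.map_mul, h2w, hwu', one_mul] at hlt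
      exact lt_irrefl _ hlt
  -- (4) the transport `Ψ : E(K̄) → T(K̄_v)`, equivariant for the inertia group
  haveI hint : ((tateFormOfJ jv).baseChange (AlgebraicClosure (v.adicCompletion K))).IsIntegral w.integer := by
    refine isIntegral_integer_of_val_le_one ?_ ?_ ?_ (hT.w_a₄_le.trans hT.w_a₆_lt.le)
      hT.w_a₆_lt.le
    · rw [hT.a₁, map_one]
    · rw [hT.a₂, map_zero]; exact zero_le_one
    · rw [hT.a₃, map_zero]; exact zero_le_one
  let Φ : localPoints W (v.adicCompletion K) ≃+ ((tateFormOfJ jv).baseChange (AlgebraicClosure (v.adicCompletion K))).toAffine.Point :=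
    (Affine.Point.congrEquiv (baseChange_baseChange_adicCompletion W v).symm).trans e
  have hΦ : ∀ σ ∈ 𝔐.inertia (absoluteGaloisGroup (v.adicCompletion K)), ∀ Q : localPoints W (v.adicCompletion K),
      Φ (σ • Q) = Affine.Point.map ((absoluteGaloisGroup.toAlgEquiv (v.adicCompletion K) σ : (AlgebraicClosure (v.adicCompletion K)) ≃ₐ[(v.adicCompletion K)] (AlgebraicClosure (v.adicCompletion K))) :
        (AlgebraicClosure (v.adicCompletion K)) →ₐ[(v.adicCompletion K)] (AlgebraicClosure (v.adicCompletion K))) (Φ Q) := by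
    intro σ hσ Q
    change e (Affine.Point.congrEquiv (baseChange_baseChange_adicCompletion W v).symm (σ • Q)) =
      Affine.Point.map ((absoluteGaloisGroup.toAlgEquiv (v.adicCompletion K) σ : (AlgebraicClosure (v.adicCompletion K)) ≃ₐ[(v.adicCompletion K)] (AlgebraicClosure (v.adicCompletion K))) : (AlgebraicClosure (v.adicCompletion K)) →ₐ[(v.adicCompletion K)] (AlgebraicClosure (v.adicCompletion K)))
        (e (Affine.Point.congrEquiv (baseChange_baseChange_adicCompletion W v).symm Q))
    rw [congrEquiv_smul, (he _).2, if_pos (hfixu σ hσ)]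
  set Ψ : geomPoints W →+ ((tateFormOfJ jv).baseChange (AlgebraicClosure (v.adicCompletion K))).toAffine.Point :=
    Φ.toAddMonoidHom.comp (pointsMap W (v.adicCompletion K)) with hΨ
  have hΨinj : Function.Injective Ψ :=
    Φ.injective.comp (pointsMapOfEmb_injective W (closureEmb (K := K) (v.adicCompletion K)))
  -- the `𝒪_w`-model of the Tate form and the kernel of reduction
  obtain ⟨M, hM⟩ := hint.integral
  set X : AddSubgroup (geomTorsion W (p : ℤ)) :=
    { carrier := {P | M.ReducesToZero (Affine.Point.congrEquiv hM (Ψ (P : geomPoints W)))}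
      zero_mem' := by
        simp only [Set.mem_setOf_eq, ZeroMemClass.coe_zero, map_zero]
        exact reducesToZero_zero
      add_mem' := by
        intro P Q hP hQ
        simp only [Set.mem_setOf_eq, AddSubgroup.coe_add, map_add] at hP hQ ⊢
        exact hP.add hvw hQ
      neg_mem' := by
        intro P hP
        simp only [Set.mem_setOf_eq, AddSubgroup.coe_neg, map_neg] at hP ⊢
        exact hP.neg } with hXdef
  have hmemX : ∀ P : geomTorsion W (p : ℤ),
      P ∈ X ↔ M.ReducesToZero (Affine.Point.congrEquiv hM (Ψ (P : geomPoints W))) :=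
    fun P ↦ Iff.rfl
  have hp0 : ((p : ℕ) : ℤ) ≠ 0 := by exact_mod_cast hp.out.ne_zero
  haveI : Finite (geomTorsion W (p : ℤ)) := finite_torsionPoints_holds W (AlgebraicClosure K) hp0
  have hpL : (p : (AlgebraicClosure (v.adicCompletion K))) ≠ 0 := by
    rw [← map_natCast (algebraMap K (AlgebraicClosure (v.adicCompletion K))) p]
    exact (map_ne_zero_iff _ (algebraMap K (AlgebraicClosure (v.adicCompletion K))).injective).mpr (Nat.cast_ne_zero.mpr hp.out.ne_zero)
  have hpw : w (p : (AlgebraicClosure (v.adicCompletion K))) < 1 := spectralValuation_natCast_lt_one hw hpv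
  refine ⟨X.map (geomTorsion W (p : ℤ)).subtype, ?_, ?_, ?_⟩
  · -- `Λ ≤ E[p]`
    rintro _ ⟨P, -, rfl⟩
    exact P.2
  · -- `#X ≤ p`: `Ψ(X)` is a subgroup of `T₁(K̄_v)` killed by `p`
    rw [Nat.card_congr (X.equivMapOfInjective (geomTorsion W (p : ℤ)).subtype
      Subtype.val_injective).toEquiv.symm]
    set Ψ' : geomTorsion W (p : ℤ) →+ ((tateFormOfJ jv).baseChange (AlgebraicClosure (v.adicCompletion K))).toAffine.Point :=
      Ψ.comp (geomTorsion W (p : ℤ)).subtype with hΨ'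
    have hΨ'inj : Function.Injective Ψ' := hΨinj.comp Subtype.val_injective
    set G := X.map Ψ' with hG
    have hGfin : (G : Set ((tateFormOfJ jv).baseChange (AlgebraicClosure (v.adicCompletion K))).toAffine.Point).Finite := by
      rw [hG, AddSubgroup.coe_map]
      exact (Set.toFinite _).image Ψ'
    haveI : Finite G := hGfin.to_subtype
    have hcard : Nat.card X = Nat.card G :=
      Nat.card_congr (X.equivMapOfInjective Ψ' hΨ'inj).toEquiv
    rw [hcard]
    have hbound := TateForm.card_addSubgroup_le_pow (tateFormOfJ jv) hT hp2 hpw hpL 1 G ?_ ?_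
    · simpa using hbound
    · -- the affine points of `G` lie in the kernel of reduction
      intro x y h hmem
      obtain ⟨P, hP, hPeq⟩ := AddSubgroup.mem_map.mp hmem
      have hP' := (hmemX P).mp hP
      have hPeq' : Ψ (P : geomPoints W) = .some x y h := hPeq
      rw [hPeq', Affine.Point.congrEquiv_some, reducesToZero_some_iff,
        not_mem_range_iff hvw] at hP'
      exact hP'
    · intro Q hmem
      obtain ⟨P, -, rfl⟩ := AddSubgroup.mem_map.mp hmem
      have hP0 : ((p : ℕ) : ℤ) • (P : geomPoints W) = 0 := (Submodule.mem_torsionBy_iff _ _).mp P.2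
      rw [pow_one, hΨ', AddMonoidHom.coe_comp, Function.comp_apply, AddSubgroup.coe_subtype,
        ← map_zsmul, hP0, map_zero]
  · -- `τ P - P ∈ X` for `τ ∈ I_{K_v}`
    intro τ hτ P₀ hP₀
    set P : geomTorsion W (p : ℤ) := ⟨P₀, hP₀⟩ with hPdef
    change absGaloisRestrict K (v.adicCompletion K) τ • (P : geomPoints W) - P ∈ _
    have hτI : τ ∈ 𝔐.inertia (absoluteGaloisGroup (v.adicCompletion K)) := by
      rwa [inertia_eq_absInertia hw h𝔐]
    set σE : (AlgebraicClosure (v.adicCompletion K)) ≃ₐ[(v.adicCompletion K)] (AlgebraicClosure (v.adicCompletion K)) := absoluteGaloisGroup.toAlgEquiv _ τ with hσE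
    have hσ₁ : ∀ z : (AlgebraicClosure (v.adicCompletion K)), w (σE z) = w z := fun z ↦ spectralValuation_smul hw τ z
    have hΨτ : Ψ (absGaloisRestrict K (v.adicCompletion K) τ • (P : geomPoints W)) = Affine.Point.map (σE : (AlgebraicClosure (v.adicCompletion K)) →ₐ[(v.adicCompletion K)] (AlgebraicClosure (v.adicCompletion K))) (Ψ P) := by
      rw [hΨ, AddMonoidHom.coe_comp, Function.comp_apply, ← resGal_eq_absGaloisRestrict, pointsMap_smul]
      exact hΦ τ hτI _
    -- membership in `Λ = X` read in `E(K̄)`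
    have hcoe : ((absGaloisRestrict K (v.adicCompletion K) τ • P - P : geomTorsion W (p : ℤ)) :
        geomPoints W) = absGaloisRestrict K (v.adicCompletion K) τ • (P : geomPoints W) - P := by
      rw [AddSubgroupClass.coe_sub, Literature.NumberTheory.EllipticCurves.AddSubgroup.torsionBy.coe_smul]
    refine AddSubgroup.mem_map.mpr ⟨_, ?_, by rw [AddSubgroup.coe_subtype, hcoe]⟩
    rw [hmemX, hcoe, map_sub, hΨτ]
    have hP0 : ((p ^ 1 : ℕ) : ℤ) • Ψ (P : geomPoints W) = 0 := by
      rw [pow_one, ← map_zsmul, (Submodule.mem_torsionBy_iff _ _).mp P.2, map_zero]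
    rcases hD : Affine.Point.map (σE : (AlgebraicClosure (v.adicCompletion K)) →ₐ[(v.adicCompletion K)] (AlgebraicClosure (v.adicCompletion K))) (Ψ P) - Ψ P with _ | ⟨s, t, hst⟩
    · rw [← Affine.Point.zero_def, map_zero]
      exact reducesToZero_zero
    · have hs : 1 < w s :=
        TateForm.one_lt_valuation_of_map_sub_eq_some_of_zsmul_eq_zero (tateFormOfJ jv) hT ha₆
          hp2 hpw σE hσ₁ (Ψ P) hP0 hD
      rw [Affine.Point.congrEquiv_some, reducesToZero_some_iff, not_mem_range_iff hvw]
      exact hs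

/-- **At a multiplicative `v ∣ p` with `e = f = 1`: `ρ̄_{E,p}|I_v ≃ (ψ₁ *; 0 1)`** (Serre 1972, §1.12,
Cor. of Prop. 13; Serre 1987, §2.9 / (2.8.2)).  Let `E` be an elliptic curve over a number field
`K`, `p` an odd prime, `v ∣ p` a finite place of multiplicative reduction with `p` a uniformiser of
`K_v` and residue field `𝔽_p`, `ρ̄ : Γ_K → GL₂(𝔽_p)` a framing of `E[p]`, `j : 𝔽_p → k` a
continuous ring homomorphism into a topological field and `ι` a residue embedding for `K_v`.  Then
the line `Λ` of `exists_line_le_geomTorsion_of_hasMultiplicativeReductionAt` has exactly `p`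
elements — some `τ ∈ I_{K_v}` has `ψ₁(τ) = -1 ≠ 1` (`exists_fundamentalCharacter_apply_eq`), so
`χ̄_p(τ) = det ρ̄(τ) ≠ 1` and `τ` moves `E[p]` — and in a basis adapted to `Λ` every
`σ ∈ I_{K_v}` acts by `(χ̄_p(σ) *; 0 1) = (ψ₁(σ) *; 0 1)`: the local representation
`(ρ̄ ⊗_j k)|Γ_{K_v}` has `HasLevelOneInertiaShape ι p _ 1 0`.
[cite: SerreInventiones1972, §1.12, Cor. of Prop. 13] [cite: Serre1987, §2.8 (2.8.2), §2.9] -/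
theorem hasLevelOneInertiaShape_restrictField_of_hasMultiplicativeReductionAt [W.IsElliptic]
    {p : ℕ} [hp : Fact p.Prime] (hp2 : p ≠ 2) {v : HeightOneSpectrum (𝓞 K)}
    (hpv : (p : 𝓞 K) ∈ v.asIdeal) (hmult : W.HasMultiplicativeReductionAt v)
    {ρ : ModPGaloisRep K (ZMod p) 2} (hρ : W.IsTorsionGaloisRep p ρ)
    {k : Type} [Field k] [TopologicalSpace k] [IsTopologicalRing k] (j : ZMod p →+* k)
    (hj : Continuous j)
    (hirr : Irreducible ((p : ℕ) : 𝒪[v.adicCompletion K]))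
    (hq : residueFieldCard (v.adicCompletion K) = p)
    (ι : absIntegers 𝒪[v.adicCompletion K] (v.adicCompletion K) ⧸
      absMaximalIdeal (v.adicCompletion K) →+* k) :
    ModPGaloisRep.HasLevelOneInertiaShape
      (FramedGaloisRep.restrictField (v.adicCompletion K) (FramedRep.baseChange j hj ρ) :
        ModPGaloisRep (v.adicCompletion K) k 2) ι ((p : ℕ) : 𝒪[v.adicCompletion K]) hirr 1 0 := by
  haveI : NeZero ((p : ℕ) : K) := ⟨Nat.cast_ne_zero.mpr hp.out.ne_zero⟩
  haveI : NeZero ((p : ℕ) : v.adicCompletion K) := neZero_natCast_of_irreducible hirr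
  haveI hchark : CharP k p := charP_of_injective_ringHom j.injective p
  have hp0 : p ≠ 0 := hp.out.ne_zero
  obtain ⟨Λ, hΛ, hcard_le, hquot⟩ :=
    W.exists_line_le_geomTorsion_of_hasMultiplicativeReductionAt hp2 hpv hmult
  have hstab : ∀ τ ∈ absInertia (v.adicCompletion K), ∀ x ∈ Λ,
      absGaloisRestrict K (v.adicCompletion K) τ • x ∈ Λ := by
    intro τ hτ x hx
    have h := Λ.add_mem (hquot τ hτ x (hΛ hx)) hx
    rwa [sub_add_cancel] at h
  /- `det ρ̄(res τ) = χ̄_p(τ)` on `Γ_{K_v}`, and `ψ₁ = χ̄_p` on `I_{K_v}` -/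
  have hdet : ∀ τ : absoluteGaloisGroup (v.adicCompletion K),
      Matrix.GeneralLinearGroup.det (ρ (absGaloisRestrict K (v.adicCompletion K) τ)) =
        modPCyclotomicCharacterZMod (v.adicCompletion K) p τ := fun τ ↦ by
    rw [det_eq_modPCyclotomicCharacter_of_isTorsionGaloisRep_holds W p ρ hρ,
      modPCyclotomicCharacterZMod_absGaloisRestrict]
  have hψ : ∀ σ : absInertia (v.adicCompletion K),
      ((fundamentalCharacter (v.adicCompletion K) 1 ι ((p : ℕ) : 𝒪[v.adicCompletion K]) hirr σ :
        kˣ) : k) = j (modPCyclotomicCharacterZMod (v.adicCompletion K) p σ : ZMod p) := fun σ ↦ by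
    rw [coe_fundamentalCharacter_one_eq_modPCyclotomicCharacter hirr hq ι j σ,
      coe_modPCyclotomicCharacter_apply]
  /- `#Λ = p`: some inertia element has `ψ₁ = -1`, hence moves `E[p]` -/
  have hcard : Nat.card Λ = p := by
    obtain ⟨τ, Z, hZ, hψτ⟩ := exists_fundamentalCharacter_apply_eq (F := v.adicCompletion K)
      one_ne_zero ι ((p : ℕ) : 𝒪[v.adicCompletion K]) hirr (-1) (by
        rw [pow_one, hq, (hp.out.even_sub_one hp2).neg_one_pow])
    have hZ1 : Z = -1 := Subtype.ext (by rw [hZ]; rfl)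
    have hψval : ((fundamentalCharacter (v.adicCompletion K) 1 ι ((p : ℕ) : 𝒪[v.adicCompletion K])
        hirr τ : kˣ) : k) = -1 := by
      rw [hψτ, hZ1, map_neg, map_one, map_neg, map_one]
    -- `χ̄_p(τ) ≠ 1`
    have hχ : modPCyclotomicCharacterZMod (v.adicCompletion K) p τ ≠ 1 := by
      intro h1
      have h2 : (j (modPCyclotomicCharacterZMod (v.adicCompletion K) p τ : ZMod p) : k) = -1 := by
        rw [← hψ τ, hψval]
      rw [h1, Units.val_one, map_one] at h2
      have h3 : (2 : k) = 0 := by linear_combination h2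
      have h4 : (p : ℕ) ∣ 2 := by
        rw [← CharP.cast_eq_zero_iff k p 2, Nat.cast_ofNat]; exact h3
      have h5 := Nat.le_of_dvd two_pos h4
      have h6 := hp.out.two_le
      exact hp2 (le_antisymm h5 h6)
    -- so `ρ̄(res τ) ≠ 1` and some `x ∈ E[p]` moves
    have hρne : ρ (absGaloisRestrict K (v.adicCompletion K) τ) ≠ 1 := fun h ↦ hχ (by
      rw [← hdet, h, map_one])
    obtain ⟨e, he⟩ := id hρ
    have hmoved : ∃ x ∈ geomTorsion W p,
        absGaloisRestrict K (v.adicCompletion K) τ • x ≠ x := by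
      by_contra hall
      push Not at hall
      apply hρne
      refine Units.ext (Matrix.ext fun i c ↦ ?_)
      have hfix : absGaloisRestrict K (v.adicCompletion K) τ • e.symm (Pi.single c 1) =
          e.symm (Pi.single c 1) := Subtype.ext (by
        rw [Literature.NumberTheory.EllipticCurves.AddSubgroup.torsionBy.coe_smul]
        exact hall _ (e.symm (Pi.single c 1)).2)
      have h1 := he (absGaloisRestrict K (v.adicCompletion K) τ) (e.symm (Pi.single c 1))
      rw [hfix, AddEquiv.apply_symm_apply] at h1
      have h2 := congrFun h1 i
      rw [Matrix.mulVec_single_one, Pi.single_apply] at h2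
      rw [Units.val_one, Matrix.one_apply]
      exact h2.symm
    obtain ⟨x, hx, hne⟩ := hmoved
    have hmem : absGaloisRestrict K (v.adicCompletion K) τ • x - x ∈ Λ := hquot τ τ.2 x hx
    have hne0 : absGaloisRestrict K (v.adicCompletion K) τ • x - x ≠ 0 := sub_ne_zero.mpr hne
    -- `#Λ ∣ p²`, `#Λ ≠ 1`, `#Λ ≤ p`
    have hA : Nat.card (geomTorsion W p) = p ^ 2 :=
      card_torsionBy_eq_sq (E := W.baseChange (AlgebraicClosure K)) (n := p) (by exact_mod_cast hp0)
    haveI : Finite (geomTorsion W p) := Nat.finite_of_card_ne_zero (by rw [hA]; positivity)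
    have hdvd : Nat.card Λ ∣ p ^ 2 := hA ▸ AddSubgroup.card_dvd_of_le hΛ
    obtain ⟨i, hi, hci⟩ := (Nat.dvd_prime_pow hp.out).mp hdvd
    interval_cases i
    · exfalso
      rw [pow_zero] at hci
      have hbot : Λ = ⊥ := AddSubgroup.eq_bot_of_card_eq Λ hci
      rw [hbot, AddSubgroup.mem_bot] at hmem
      exact hne0 hmem
    · rw [hci, pow_one]
    · exfalso
      rw [hci] at hcard_le
      have : p ^ 2 ≤ p ^ 1 := by rwa [pow_one]
      exact absurd (Nat.pow_le_pow_iff_right hp.out.one_lt |>.mp this) (by norm_num)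
  /- the adapted basis -/
  obtain ⟨Q, hQ⟩ := IsTorsionGaloisRep.exists_conj_eq_of_line hρ hΛ hcard hstab hquot
  refine ⟨Matrix.GeneralLinearGroup.map j Q⁻¹, fun σ ↦ ?_⟩
  obtain ⟨c, hc⟩ := hQ σ σ.2
  refine ⟨j c, ?_⟩
  have hmat : ((Matrix.GeneralLinearGroup.map j Q⁻¹ *
        (FramedGaloisRep.restrictField (v.adicCompletion K) (FramedRep.baseChange j hj ρ) :
          ModPGaloisRep (v.adicCompletion K) k 2) (σ : absoluteGaloisGroup (v.adicCompletion K)) *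
        (Matrix.GeneralLinearGroup.map j Q⁻¹)⁻¹ : GL (Fin 2) k) : Matrix (Fin 2) (Fin 2) k) =
      (((Q⁻¹ * ρ (absGaloisRestrict K (v.adicCompletion K) σ) * Q : GL (Fin 2) (ZMod p)) :
        Matrix (Fin 2) (Fin 2) (ZMod p))).map j := by
    rw [FramedGaloisRep.restrictField_apply, Matrix.GeneralLinearGroup.coe_mul,
      Matrix.GeneralLinearGroup.coe_mul, FramedRep.coe_baseChange_apply, map_inv, inv_inv,
      Matrix.GeneralLinearGroup.coe_mul, Matrix.GeneralLinearGroup.coe_mul, Matrix.map_mul,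
      Matrix.map_mul]
    rfl
  have hmap : ∀ (a b c d : ZMod p), (!![a, b; c, d] : Matrix (Fin 2) (Fin 2) (ZMod p)).map j =
      !![j a, j b; j c, j d] := fun a b c d ↦ by
    ext i i'
    fin_cases i <;> fin_cases i' <;> rfl
  rw [hmat, hc, hmap, pow_one, pow_zero, Units.val_one, hψ σ, hdet, map_zero, map_one]

end WeierstrassCurve
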